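import Literature.NumberTheory.LFunctions.CertifiedArtinHolomorphyCriterion
import Literature.NumberTheory.LFunctions.HeilbronnBound
import Literature.RepresentationTheory.FiniteGroups.ProductGroupCharacters
import Literature.RepresentationTheory.FiniteGroups.CentralProductCharacters
import HarnessLib

/-!
# Weak almost monomial groups and Artin's conjecture at a point (Cimpoeaş 2024): the notion,
# Booker-almost-monomial ⇒ weak almost monomial (proved), and the simple-zero criterion
# (Theorem 3.2, proved over the tree's Heilbronn–Artin formalism)

Topic `Literature/NumberTheory/LFunctions`; namespace `Literature.NumberTheory.LFunctions`, grouping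
namespace `Cimpoeas2024` for the group-theoretic notions. Companion of
`CertifiedArtinHolomorphyCriterion.lean` (Booker 2006 §2: `Booker2006.IsDMPositive`,
`Booker2006.IsAlmostMonomial` = "BAM-group" below) and of the Heilbronn files
(`HeilbronnArtinOrder`, `HeilbronnCharacter`, `HeilbronnBound`: `Heilbronn.artinOrder s₀ (φ ∘ q)` =
the order at `s₀` of the Artin `L`-function of the character `φ` of a Galois group `G` exhibited by
`q : Γ_F → G`, additivity, `⟨φ, θ_G⟩ = n(G, φ)`, and `n(G, Ind_H^G λ) ≥ 0` off `s₀ = 1`). Typed for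
the parity-realchar cell (D-0088 (4) literature-typing layer, row «Booker 2006 (Artin, Turing, class
numbers)», recent-theorem harvest: the 2024 continuation of Booker's §2 criterion), statement-first
(D-0064): definitions with bodies, the printed results PROVED where the tree's vocabulary allows,
otherwise named facts (D-0014). The source is a PREPRINT (arXiv:2409.05629v1, 9 Sep 2024, version of
record checked 2026-08-26; not yet in a journal per zbMATH); its Theorems 2.9 and 2.10 were first typed
as CLAIM facts (D-0012) and are now DISCHARGED in this file (`cimpoeas2024_theorem29_holds`,
`cimpoeas2024_theorem210_holds`).

Source: M. Cimpoeaş, *Weak almost monomial groups and Artin's conjecture*, arXiv:2409.05629v1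
[Cimpoeas2024WAM] (MSC 20C15, 11R42), §2 pp. 3–6, §3 pp. 6–7. Setting (§2 p. 3): `Irr(G) =
{χ₁, …, χ_r}`; "A character `χ` is monomial if there exist a subgroup `H ≤ G` and a linear character
`λ` of `H` such that `λ^G = χ`" — the tree's `indClassFun H λ` with `λ : H →* ℂˣ`
(`isCharacter_indClassFun_monoidHom`); `⟨·,·⟩` = `classInner`.

## Contents

* `Cimpoeas2024.IsNicolaeAlmostMonomial G` — **Definition 2.2** (p. 4; Nicolae's "NAM-group"): for
  every two distinct `χᵢ ≠ χⱼ ∈ Irr(G)` there is a monomial `σ` with `χᵢ ∈ Cons(σ)` and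
  `χⱼ ∉ Cons(σ)` (constituent = positive multiplicity `⟨χ, σ⟩ ≠ 0`).
* `Cimpoeas2024.IsWeakAlmostMonomial G` — **Definition 2.3** (p. 4; "WAM-group"), verbatim with the
  Introduction's unfolding (p. 2): "for every distinct complex irreducible characters `χ` and `χ'` of
  `G` there exist a subgroup `H` of `G` and a linear character `λ` of `H` such that
  `⟨χ, λ^G⟩ > ⟨χ', λ^G⟩`".
* PROVED **Proposition 2.4** (p. 4): (1) `Booker2006.IsAlmostMonomial G → IsWeakAlmostMonomial G`
  (`isWeakAlmostMonomial_of_isAlmostMonomial`, the paper's three-line argument: if no monomial `σ`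
  separates `χᵢ` from `χⱼ` then `χⱼ = (χⱼ − χᵢ) + χᵢ` is a forbidden DM-positive decomposition);
  (2) `IsNicolaeAlmostMonomial G → IsWeakAlmostMonomial G`. Also PROVED: an M-group is a NAM-group
  (`isNicolaeAlmostMonomial_of_isMGroup`; §1 p. 2, the chain monomial ⊂ NAM ⊂ WAM).
* CLAIM facts `cimpoeas2024_theorem29` (**Theorem 2.9** p. 6: quotients of WAM-groups are WAM) and
  `cimpoeas2024_theorem210` (**Theorem 2.10** p. 6: `G, G'` WAM ⟺ `G × G'` WAM); both
  DISCHARGED (`cimpoeas2024_theorem29_holds`, `cimpoeas2024_theorem210_holds`): (1) ⇒ (2) of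
  Theorem 2.10 by `Cimpoeas2024.IsWeakAlmostMonomial.prod` (factorisation `indClassFun_prod_eq`:
  `Ind_{H×H'}^{G×G'}(λ ⊠ λ') = Ind_H^G λ ⊠ Ind_{H'}^{G'} λ'`), Theorem 2.9 and (2) ⇒ (1) by the descent
  `Cimpoeas2024.IsWeakAlmostMonomial.of_surjective` along any surjection `Γ ↠ K`.
* PROVED, by the same descent/inflation machinery run for DM-positivity (Booker's own proof),
  **Booker 2006 Proposition 2.2** in both halves (`Booker2006.IsAlmostMonomial.of_surjective` /
  `.quotient`, `Booker2006.IsAlmostMonomial.prod_of_isMGroup`), DISCHARGING the named fact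
  `booker2006_proposition22` of `CertifiedArtinHolomorphyCriterion.lean` (`booker2006_proposition22_holds`);
  the monomial form of Brauer's induction theorem (the tree's `brauer_induction_holds`) enters through
  `eq_zero_of_forall_classInner_ind_eq_zero`.
* PROVED **Theorem 3.2** (p. 7) — `cimpoeas2024_theorem32`: "If the Galois group `G` is weak almost
  monomial and there exists some `k` such that `ord_{s=s₀}(f_k) = 1` and `f_ℓ(s₀) ≠ 0` for all
  `ℓ ≠ k`, then all Artin L-functions of `K/ℚ` are holomorphic at `s₀`" (`f_i = L(s, χᵢ)`,
  `s₀ ∈ ℂ ∖ {1}` fixed, §3 p. 6), in the tree's vocabulary: `ord_{s₀} f_i = Heilbronn.artinOrder s₀ (χᵢ ∘ q)`,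
  "`f_ℓ(s₀) ≠ 0`" = "`s₀` is not a zero of `f_ℓ`" = `artinOrder ≤ 0`, conclusion `artinOrder ≥ 0` for
  every irreducible (hence, by additivity, every) character. The tree's formalism is over an
  arbitrary number field `F` (the source: `K/ℚ`); the printed proof is verbatim the same.

NOT typed: **Theorem 3.1** (Artin's conjecture at `s₀` ⟺ the monoid `Hol(s₀)` of Artin `L`-functions
holomorphic at `s₀` is factorial — needs the affine-monoid vocabulary of [Nicolae], not in the tree);
Proposition 2.5 and the Hilbert-basis bookkeeping; the GAP verdicts of Examples 2.6–2.8 and §4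
(`SL₂(𝔽₃)`, `GL₂(𝔽₃)`, "`A₆` is a BAM-group … but not a NAM-group", "`A₇, A₈, A₁₀–A₁₃` are not weak
almost monomial", "`M₁₀` is weak almost monomial but not a NAM-group", …) — recorded here, not filed.

`lean search` (2026-08-26): "weak almost monomial", "NAM", "Nicolae" occur nowhere in the tree;
`Booker2006.IsAlmostMonomial/IsDMPositive`, `IsMGroup`, `irrChars`, `virtChars`, `classInner`,
`indClassFun`, `Heilbronn.artinOrder`, `Heilbronn.heilbronnChar`, `Automorphic.IsArtinQuotient` are
reused, not re-declared.

## References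

* [Cimpoeas2024WAM] M. Cimpoeaş, *Weak almost monomial groups and Artin's conjecture*,
  arXiv:2409.05629v1 (2024): Definitions 2.1–2.3, Proposition 2.4 (pp. 3–4), Theorems 2.9–2.10
  (p. 6), §3 and Theorems 3.1–3.2 (pp. 6–7).
* [Booker2006] A. R. Booker, Experiment. Math. 15 (2006) 385–407, §2 Definition 2.1.
* [MurtyMurty1997] M. R. Murty, V. K. Murty, *Non-vanishing of L-functions and applications*,
  Ch. 2 §5 (Heilbronn's formalism).
-/

noncomputable section

open scoped ComplexOrder

namespace Literature.NumberTheory.LFunctions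

open Literature.RepresentationTheory.FiniteGroups Booker2006

namespace Cimpoeas2024

variable {G : Type} [Group G] [Fintype G]

/-- **Cimpoeaş 2024, Definition 2.2 (p. 4; Nicolae's almost monomial groups, "NAM-group"), as
printed:** "A finite group `G` is called almost monomial in Nicolae's sense (or a NAM-group) if for
every two distinct characters `χᵢ ≠ χⱼ ∈ Irr(G)`, there exists a monomial character `σ` such that
`χᵢ ∈ Cons(σ)` and `χⱼ ∉ Cons(σ)`" (`Cons(ψ)` = the set of constituents of `ψ`, p. 3, i.e. the
irreducible `χ` with `⟨χ, ψ⟩ ≠ 0`; monomial `σ = λ^G`, `λ` a linear character of a subgroup `H`, p. 3).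
[cite: Cimpoeas2024WAM, Definition 2.2 p. 4] -/
def IsNicolaeAlmostMonomial (G : Type) [Group G] [Fintype G] : Prop :=
  ∀ χ₁ ∈ irrChars G, ∀ χ₂ ∈ irrChars G, χ₁ ≠ χ₂ →
    ∃ (H : Subgroup G) (θ : H →* ℂˣ),
      classInner χ₁ (indClassFun H fun h => (θ h : ℂ)) ≠ 0 ∧
        classInner χ₂ (indClassFun H fun h => (θ h : ℂ)) = 0

/-- **Cimpoeaş 2024, Definition 2.3 (p. 4; "WAM-group"), as printed:** "A finite group `G` is called
weak almost monomial (or a WAM-group) if for every two distinct characters `χᵢ ≠ χⱼ ∈ Irr(G)`, there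
exist a monomial character `σ` such that `⟨χᵢ, σ⟩ > ⟨χⱼ, σ⟩`", unfolded as in the Introduction (p. 2):
"there exist a subgroup `H` of `G` and a linear character `λ` of `H` such that
`⟨χ, λ^G⟩ > ⟨χ', λ^G⟩`" (in `ℂ` with Mathlib's order: both sides are natural numbers).
[cite: Cimpoeas2024WAM, Definition 2.3 p. 4] -/
def IsWeakAlmostMonomial (G : Type) [Group G] [Fintype G] : Prop :=
  ∀ χ₁ ∈ irrChars G, ∀ χ₂ ∈ irrChars G, χ₁ ≠ χ₂ →
    ∃ (H : Subgroup G) (θ : H →* ℂˣ),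
      classInner χ₂ (indClassFun H fun h => (θ h : ℂ)) <
        classInner χ₁ (indClassFun H fun h => (θ h : ℂ))

/-! ### Integrality bookkeeping -/

/-- `⟨χ, λ^G⟩ ∈ ℕ` for an irreducible `χ` and a monomial `λ^G`. [folklore] -/
private theorem exists_nat_classInner_ind {χ : G → ℂ} (hχ : χ ∈ irrChars G) (H : Subgroup G)
    (θ : H →* ℂˣ) : ∃ n : ℕ, classInner χ (indClassFun H fun h => (θ h : ℂ)) = n :=
  (IsIrrChar.isCharacter hχ).classInner_natCast (isCharacter_indClassFun_monoidHom H θ)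

/-- In `ℂ` with Mathlib's order, `(m : ℂ) < (n : ℂ) ↔ m < n` for naturals. [folklore] -/
private theorem natCast_lt_natCast {m n : ℕ} : (m : ℂ) < (n : ℂ) ↔ m < n := by
  rw [← Complex.ofReal_natCast, ← Complex.ofReal_natCast, Complex.real_lt_real]
  exact_mod_cast Iff.rfl

/-- In `ℂ` with Mathlib's order, `(m : ℂ) ≤ (n : ℂ) ↔ m ≤ n` for naturals. [folklore] -/
private theorem natCast_le_natCast {m n : ℕ} : (m : ℂ) ≤ (n : ℂ) ↔ m ≤ n := by
  rw [← Complex.ofReal_natCast, ← Complex.ofReal_natCast, Complex.real_le_real]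
  exact_mod_cast Iff.rfl

/-- `⟨φ − φ', ψ⟩ = ⟨φ, ψ⟩ − ⟨φ', ψ⟩`. [folklore] -/
private theorem classInner_sub_left'' (φ φ' ψ : G → ℂ) :
    classInner (φ - φ') ψ = classInner φ ψ - classInner φ' ψ := by
  have h : φ - φ' = φ + (-1 : ℂ) • φ' := by
    ext g; simp [sub_eq_add_neg]
  rw [h, classInner_add_left, classInner_smul_left]
  ring

/-- An irreducible character is not the zero function (`⟨χ, χ⟩ = 1`). [folklore] -/
private theorem ne_zero_of_mem_irrChars {χ : G → ℂ} (hχ : χ ∈ irrChars G) : χ ≠ 0 := by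
  intro h0
  have h1 := IsIrrChar.classInner_eq (G := G) hχ hχ
  rw [if_pos rfl, h0, classInner_zero_left] at h1
  exact zero_ne_one h1

/-! ### Proposition 2.4 and the chain monomial ⊂ NAM ⊂ WAM (proved) -/

/-- **Cimpoeaş 2024, Proposition 2.4 (1) (p. 4): "If `G` is a BAM-group then `G` is a WAM-group"**
(BAM-group = almost monomial in Booker's sense, Definition 2.1 = Booker 2006 Def. 2.1 =
`Booker2006.IsAlmostMonomial`). The printed proof: if for some `i ≠ j` no monomial `σ` has
`⟨χᵢ, σ⟩ > ⟨χⱼ, σ⟩`, then `⟨χᵢ, σ⟩ ≤ ⟨χⱼ, σ⟩` for all monomial `σ`, so `χⱼ = ψ + φ` with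
`ψ = χⱼ − χᵢ`, `φ = χᵢ` both DM-positive and non-zero, contradicting Definition 2.1.
[cite: Cimpoeas2024WAM, Proposition 2.4 (1) p. 4] -/
theorem isWeakAlmostMonomial_of_isAlmostMonomial (hG : IsAlmostMonomial G) :
    IsWeakAlmostMonomial G := by
  intro χ₁ hχ₁ χ₂ hχ₂ hne
  by_contra hnot
  push Not at hnot
  -- `⟨χ₁, σ⟩ ≤ ⟨χ₂, σ⟩` for every monomial `σ`
  have hle : ∀ (H : Subgroup G) (θ : H →* ℂˣ),
      classInner χ₁ (indClassFun H fun h => (θ h : ℂ)) ≤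
        classInner χ₂ (indClassFun H fun h => (θ h : ℂ)) := by
    intro H θ
    obtain ⟨n₁, hn₁⟩ := exists_nat_classInner_ind hχ₁ H θ
    obtain ⟨n₂, hn₂⟩ := exists_nat_classInner_ind hχ₂ H θ
    have h := hnot H θ
    rw [hn₁, hn₂] at h ⊢
    rw [natCast_le_natCast]
    rw [natCast_lt_natCast] at h
    omega
  have hpos₁ : IsDMPositive (χ₂ - χ₁) := by
    intro H θ
    rw [classInner_sub_left'']
    exact sub_nonneg.mpr (hle H θ)
  have hpos₂ : IsDMPositive χ₁ := by
    intro H θ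
    obtain ⟨n₁, hn₁⟩ := exists_nat_classInner_ind hχ₁ H θ
    rw [hn₁]
    exact_mod_cast Nat.zero_le n₁
  have hmem₁ : χ₂ - χ₁ ∈ virtChars G :=
    sub_mem (IsIrrChar.mem_virtChars hχ₂) (IsIrrChar.mem_virtChars hχ₁)
  have hmem₂ : χ₁ ∈ virtChars G := IsIrrChar.mem_virtChars hχ₁
  rcases hG χ₂ hχ₂ (χ₂ - χ₁) hmem₁ χ₁ hmem₂ hpos₁ hpos₂ (by abel) with h | h
  · exact hne (sub_eq_zero.mp h).symm
  · exact ne_zero_of_mem_irrChars hχ₁ h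

/-- **Cimpoeaş 2024, Proposition 2.4 (2) (p. 4): "If `G` is a NAM-group then `G` is a WAM-group"**
("`χᵢ ∈ Cons(σ)` is equivalent to `⟨χᵢ, σ⟩ > 0` and `χⱼ ∉ Cons(σ)` is equivalent to `⟨χⱼ, σ⟩ = 0`").
[cite: Cimpoeas2024WAM, Proposition 2.4 (2) p. 4] -/
theorem isWeakAlmostMonomial_of_isNicolaeAlmostMonomial (hG : IsNicolaeAlmostMonomial G) :
    IsWeakAlmostMonomial G := by
  intro χ₁ hχ₁ χ₂ hχ₂ hne
  obtain ⟨H, θ, h₁, h₂⟩ := hG χ₁ hχ₁ χ₂ hχ₂ hne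
  refine ⟨H, θ, ?_⟩
  obtain ⟨n₁, hn₁⟩ := exists_nat_classInner_ind hχ₁ H θ
  rw [h₂, hn₁]
  rw [hn₁] at h₁
  have hn : n₁ ≠ 0 := by exact_mod_cast h₁
  have h := (natCast_lt_natCast (m := 0) (n := n₁)).mpr (Nat.pos_of_ne_zero hn)
  simpa using h

/-- **Monomial groups are NAM-groups** (the first link of the chain monomial ⊂ NAM ⊂ WAM of §1,
p. 2: in an M-group `σ = χᵢ` itself is monomial, contains `χᵢ` and not `χⱼ` by orthonormality).
[cite: Cimpoeas2024WAM, §1 p. 2 and Definition 2.2 p. 4] -/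
theorem isNicolaeAlmostMonomial_of_isMGroup (hG : IsMGroup G) : IsNicolaeAlmostMonomial G := by
  intro χ₁ hχ₁ χ₂ hχ₂ hne
  obtain ⟨H, θ, hχeq⟩ := hG.exists_eq_indClassFun χ₁ hχ₁
  refine ⟨H, θ, ?_, ?_⟩
  · rw [← hχeq, IsIrrChar.classInner_eq (G := G) hχ₁ hχ₁, if_pos rfl]
    exact one_ne_zero
  · rw [← hχeq, IsIrrChar.classInner_eq (G := G) hχ₂ hχ₁, if_neg (Ne.symm hne)]

/-- The chain closes: an M-group is weak almost monomial. [cite: Cimpoeas2024WAM, §1 p. 2] -/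
theorem isWeakAlmostMonomial_of_isMGroup (hG : IsMGroup G) : IsWeakAlmostMonomial G :=
  isWeakAlmostMonomial_of_isNicolaeAlmostMonomial (isNicolaeAlmostMonomial_of_isMGroup hG)

/-! ### Theorem 2.10, (1) ⇒ (2): direct products of WAM-groups (proved; appended 2026-08-26)

"it follows from the fact that the irreducible characters of `G × G'` are of the form `χ × χ'`"
(p. 6): with the tree's `exists_eq_boxProd_of_mem_irrChars` / `classInner_boxProd`
(`ProductGroupCharacters`) and the factorisation `Ind_{H×H'}^{G×G'}(λ ⊠ λ') = Ind_H^G λ ⊠ Ind_{H'}^{G'} λ'`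
proved below, a pair `χ₁ = ψ₁ ⊠ φ₁ ≠ χ₂ = ψ₂ ⊠ φ₂` is separated by `λ ⊠ λ'` where `λ` separates
`ψ₁, ψ₂` (or is `Ind_1^G 1 = r_G` when `ψ₁ = ψ₂`) and likewise `λ'`. -/

section Products

variable {G' : Type} [Group G'] [Fintype G']

/-- The external product `λ ⊠ λ'` of linear characters of `H ≤ G`, `H' ≤ G'` as a linear character
of `H × H' ≤ G × G'` (plumbing). [folklore] -/
private def prodLin (H : Subgroup G) (H' : Subgroup G') (θ : H →* ℂˣ) (θ' : H' →* ℂˣ) :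
    H.prod H' →* ℂˣ where
  toFun x := θ ⟨x.1.1, (Subgroup.mem_prod.mp x.2).1⟩ * θ' ⟨x.1.2, (Subgroup.mem_prod.mp x.2).2⟩
  map_one' := by
    have h1 : (⟨(1 : G × G').1, (Subgroup.mem_prod.mp (H.prod H').one_mem).1⟩ : H) = 1 := rfl
    have h2 : (⟨(1 : G × G').2, (Subgroup.mem_prod.mp (H.prod H').one_mem).2⟩ : H') = 1 := rfl
    simp only [OneMemClass.coe_one]
    rw [h1, h2, map_one, map_one, one_mul]
  map_mul' x y := by
    have h1 : (⟨(x * y : H.prod H').1.1, (Subgroup.mem_prod.mp (x * y).2).1⟩ : H) =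
        ⟨x.1.1, (Subgroup.mem_prod.mp x.2).1⟩ * ⟨y.1.1, (Subgroup.mem_prod.mp y.2).1⟩ := rfl
    have h2 : (⟨(x * y : H.prod H').1.2, (Subgroup.mem_prod.mp (x * y).2).2⟩ : H') =
        ⟨x.1.2, (Subgroup.mem_prod.mp x.2).2⟩ * ⟨y.1.2, (Subgroup.mem_prod.mp y.2).2⟩ := rfl
    rw [h1, h2, map_mul, map_mul]
    exact mul_mul_mul_comm _ _ _ _

omit [Fintype G] [Fintype G'] in
/-- Unfolding of `prodLin`: `(λ ⊠ λ')(x) = λ(x₁) λ'(x₂)`. [folklore] -/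
private theorem prodLin_apply (H : Subgroup G) (H' : Subgroup G') (θ : H →* ℂˣ) (θ' : H' →* ℂˣ)
    (x : H.prod H') :
    prodLin H H' θ θ' x =
      θ ⟨x.1.1, (Subgroup.mem_prod.mp x.2).1⟩ * θ' ⟨x.1.2, (Subgroup.mem_prod.mp x.2).2⟩ := rfl

omit [Fintype G] [Fintype G'] in
/-- Extension by zero of `λ ⊠ λ'` from `H × H'` is the product of the extensions by zero.
[folklore] -/
private theorem extend_prodLin (H : Subgroup G) (H' : Subgroup G') (θ : H →* ℂˣ)
    (θ' : H' →* ℂˣ) (a : G) (a' : G') :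
    Function.extend (Subtype.val : H.prod H' → G × G') (fun x => (prodLin H H' θ θ' x : ℂ)) 0
        (a, a') =
      Function.extend (Subtype.val : H → G) (fun h => (θ h : ℂ)) 0 a *
        Function.extend (Subtype.val : H' → G') (fun h => (θ' h : ℂ)) 0 a' := by
  by_cases ha : a ∈ H
  · by_cases ha' : a' ∈ H'
    · have hmem : (a, a') ∈ H.prod H' := Subgroup.mem_prod.mpr ⟨ha, ha'⟩
      have e0 := extend_subtypeVal_apply (H.prod H') (fun x => (prodLin H H' θ θ' x : ℂ)) ⟨(a, a'), hmem⟩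
      have e1 := extend_subtypeVal_apply H (fun h => (θ h : ℂ)) ⟨a, ha⟩
      have e2 := extend_subtypeVal_apply H' (fun h => (θ' h : ℂ)) ⟨a', ha'⟩
      simp only [] at e0 e1 e2
      rw [e0, e1, e2, prodLin_apply, Units.val_mul]
    · rw [extend_subtypeVal_of_not_mem H' _ ha', mul_zero,
        extend_subtypeVal_of_not_mem (H.prod H') _ (fun h => ha' (Subgroup.mem_prod.mp h).2)]
  · rw [extend_subtypeVal_of_not_mem H _ ha, zero_mul,
      extend_subtypeVal_of_not_mem (H.prod H') _ (fun h => ha (Subgroup.mem_prod.mp h).1)]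

/-- **`Ind_{H×H'}^{G×G'}(λ ⊠ λ') = Ind_H^G λ ⊠ Ind_{H'}^{G'} λ'`** (from Serre's formula
`Ind φ (s) = |H|⁻¹ Σ_t φ̇(t⁻¹ s t)`, the sum over `G × G'` factorising).
[cite: Cimpoeas2024WAM, Theorem 2.10 p. 6 (proof)] -/
theorem indClassFun_prod_eq (H : Subgroup G) (H' : Subgroup G') (θ : H →* ℂˣ) (θ' : H' →* ℂˣ)
    (s : G) (s' : G') :
    indClassFun (H.prod H') (fun x => (prodLin H H' θ θ' x : ℂ)) (s, s') =
      indClassFun H (fun h => (θ h : ℂ)) s * indClassFun H' (fun h => (θ' h : ℂ)) s' := by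
  classical
  rw [indClassFun_apply, indClassFun_apply, indClassFun_apply, Fintype.sum_prod_type]
  simp only [Prod.inv_mk, Prod.mk_mul_mk, extend_prodLin]
  rw [← Finset.sum_mul_sum]
  have hcard : (Nat.card (H.prod H') : ℂ) = Nat.card H * Nat.card H' := by
    rw [Nat.card_congr (Subgroup.prodEquiv H H').toEquiv, Nat.card_prod, Nat.cast_mul]
  rw [hcard, mul_inv]
  ring

/-- Function form of `indClassFun_prod_eq`. [cite: Cimpoeas2024WAM, Theorem 2.10 p. 6 (proof)] -/
theorem indClassFun_prod_eq_boxProd (H : Subgroup G) (H' : Subgroup G') (θ : H →* ℂˣ)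
    (θ' : H' →* ℂˣ) :
    indClassFun (H.prod H') (fun x => (prodLin H H' θ θ' x : ℂ)) =
      fun p : G × G' => indClassFun H (fun h => (θ h : ℂ)) p.1 * indClassFun H' (fun h => (θ' h : ℂ)) p.2 := by
  funext p
  obtain ⟨s, s'⟩ := p
  exact indClassFun_prod_eq H H' θ θ' s s'

/-- `⟨ψ, Ind_1^G 1⟩ = ψ(1)` (the regular character is monomial). [folklore] -/
private theorem classInner_ind_bot_one {K : Type} [Group K] [Fintype K] (ψ : K → ℂ) :
    classInner ψ (indClassFun (⊥ : Subgroup K) fun h => ((1 : (⊥ : Subgroup K) →* ℂˣ) h : ℂ)) =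
      ψ 1 := by
  classical
  have h1 : (fun h : (⊥ : Subgroup K) => ((1 : (⊥ : Subgroup K) →* ℂˣ) h : ℂ)) = fun _ => (1 : ℂ) := by
    funext h; simp
  rw [h1, Heilbronn.indClassFun_bot_one, classInner_comm, classInner_leftRegular]

/-- Separating data on one factor: for irreducible `ψ₁, ψ₂` of a WAM-group there are `H, λ` and
naturals `a₁ = ⟨ψ₁, λ^G⟩`, `a₂ = ⟨ψ₂, λ^G⟩` with `a₂ ≤ a₁`, `0 < a₁`, and `a₂ < a₁` when `ψ₁ ≠ ψ₂`
(`λ^G = r_G` when `ψ₁ = ψ₂`). [cite: Cimpoeas2024WAM, Theorem 2.10 p. 6 (proof)] -/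
private theorem exists_separating {K : Type} [Group K] [Fintype K] (hK : IsWeakAlmostMonomial K)
    {ψ₁ ψ₂ : K → ℂ} (hψ₁ : ψ₁ ∈ irrChars K) (hψ₂ : ψ₂ ∈ irrChars K) :
    ∃ (H : Subgroup K) (θ : H →* ℂˣ) (a₁ a₂ : ℕ),
      classInner ψ₁ (indClassFun H fun h => (θ h : ℂ)) = a₁ ∧
        classInner ψ₂ (indClassFun H fun h => (θ h : ℂ)) = a₂ ∧
          a₂ ≤ a₁ ∧ 0 < a₁ ∧ (ψ₁ ≠ ψ₂ → a₂ < a₁) := by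
  classical
  by_cases h : ψ₁ = ψ₂
  · subst h
    obtain ⟨d, hd, hd1⟩ := IsIrrChar.exists_apply_one_eq_natCast (G := K) hψ₁
    refine ⟨⊥, 1, d, d, ?_, ?_, le_rfl, hd, fun hne => (hne rfl).elim⟩
    · rw [classInner_ind_bot_one, hd1]
    · rw [classInner_ind_bot_one, hd1]
  · obtain ⟨H, θ, hlt⟩ := hK ψ₁ hψ₁ ψ₂ hψ₂ h
    obtain ⟨a₁, ha₁⟩ := exists_nat_classInner_ind hψ₁ H θ
    obtain ⟨a₂, ha₂⟩ := exists_nat_classInner_ind hψ₂ H θ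
    rw [ha₁, ha₂, natCast_lt_natCast] at hlt
    exact ⟨H, θ, a₁, a₂, ha₁, ha₂, hlt.le, lt_of_le_of_lt (Nat.zero_le _) hlt, fun _ => hlt⟩

/-- **Cimpoeaş 2024, Theorem 2.10 (1) ⇒ (2) (p. 6) — PROVED:** the direct product of two
WAM-groups is a WAM-group ("it follows from the fact that the irreducible characters of `G × G'`
are of the form `χ × χ'`"). (The converse direction (2) ⇒ (1) is the source's appeal to Theorem 2.9
and stays inside the CLAIM `cimpoeas2024_theorem210`.) [cite: Cimpoeas2024WAM, Theorem 2.10 p. 6] -/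
theorem IsWeakAlmostMonomial.prod (hG : IsWeakAlmostMonomial G) (hG' : IsWeakAlmostMonomial G') :
    IsWeakAlmostMonomial (G × G') := by
  classical
  intro χ₁ hχ₁ χ₂ hχ₂ hne
  obtain ⟨ψ₁, hψ₁, φ₁, hφ₁, rfl⟩ := exists_eq_boxProd_of_mem_irrChars hχ₁
  obtain ⟨ψ₂, hψ₂, φ₂, hφ₂, rfl⟩ := exists_eq_boxProd_of_mem_irrChars hχ₂
  obtain ⟨H, θ, a₁, a₂, ha₁, ha₂, ha, ha0, hane⟩ := exists_separating hG hψ₁ hψ₂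
  obtain ⟨H', θ', b₁, b₂, hb₁, hb₂, hb, hb0, hbne⟩ := exists_separating hG' hφ₁ hφ₂
  have hlt : a₂ * b₂ < a₁ * b₁ := by
    by_cases hψ : ψ₁ = ψ₂
    · have hφ : φ₁ ≠ φ₂ := by
        rintro rfl; subst hψ; exact hne rfl
      have h1 := hbne hφ
      calc a₂ * b₂ ≤ a₁ * b₂ := Nat.mul_le_mul_right _ ha
        _ < a₁ * b₁ := Nat.mul_lt_mul_of_pos_left h1 ha0
    · have h1 := hane hψ
      calc a₂ * b₂ ≤ a₂ * b₁ := Nat.mul_le_mul_left _ hb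
        _ < a₁ * b₁ := Nat.mul_lt_mul_of_pos_right h1 hb0
  refine ⟨H.prod H', prodLin H H' θ θ', ?_⟩
  rw [indClassFun_prod_eq_boxProd, classInner_boxProd, classInner_boxProd, ha₁, ha₂, hb₁, hb₂]
  have h := (natCast_lt_natCast (m := a₂ * b₂) (n := a₁ * b₁)).mpr hlt
  push_cast at h
  exact h

end Products

/-! ### Descent along surjections: Theorem 2.9 and Theorem 2.10 (2) ⇒ (1) (proved; appended 2026-08-26)

The source's argument for Theorem 2.9 ("`λ` induces a linear character `λ̃` of `HN/N` … with the same
inner products", p. 6), run for an arbitrary surjection `π : Γ ↠ K` instead of `G ↠ G/N`: pull the two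
irreducible characters back to `Γ`, separate them there by `Ind_M^Γ μ`, and push `μ` down to
`λ` on `R = π(M) ≤ K`. If `μ` is non-trivial on `M ∩ ker π` both inner products vanish (translation
by an element of the kernel multiplies the Frobenius sum by `μ(n₀) ≠ 1`), which the strict inequality
forbids; otherwise `μ = λ ∘ π` and the Frobenius sums on `M` and on `R` agree fibre by fibre. -/

section Descent

/-- Summing a function of `f(m)` over `M` for a surjective homomorphism `f : M ↠ R`: every fibre has
`|ker f|` elements. [folklore] -/
private theorem sum_comp_eq_card_ker_mul_sum {M R : Type} [Group M] [Fintype M] [Group R]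
    [Fintype R] (f : M →* R) (hf : Function.Surjective f) (F : R → ℂ) :
    ∑ m : M, F (f m) = (Nat.card f.ker : ℂ) * ∑ r : R, F r := by
  classical
  rw [← Finset.sum_fiberwise' Finset.univ f F, Finset.mul_sum]
  refine Finset.sum_congr rfl fun r _ => ?_
  rw [Finset.sum_const, nsmul_eq_mul]
  congr 1
  have h1 : (Finset.univ.filter fun m : M => f m = r).card = Fintype.card {m : M // f m = r} :=
    (Fintype.card_subtype _).symm
  have h2 : Fintype.card {m : M // f m = r} = Nat.card f.ker := by
    rw [← Nat.card_eq_fintype_card]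
    exact Nat.card_congr (MonoidHom.fiberEquivKerOfSurjective hf r)
  rw [h1, h2]

/-- Values of `μ` on a fibre of `f` agree when `μ` is trivial on `ker f`. [folklore] -/
private theorem apply_eq_of_map_eq {M R : Type} [Group M] [Group R] (f : M →* R) (μ : M →* ℂˣ)
    (hμ : ∀ n : M, f n = 1 → μ n = 1) {m m' : M} (h : f m = f m') : μ m = μ m' := by
  have h1 : μ (m'⁻¹ * m) = 1 := hμ _ (by rw [map_mul, map_inv, h, inv_mul_cancel])
  rw [map_mul, map_inv, inv_mul_eq_one] at h1
  exact h1.symm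

/-- Push-forward of a linear character `μ` of `M`, trivial on `ker f`, along a surjection
`f : M ↠ R` (plumbing; the source's `λ̃`). [folklore] -/
private noncomputable def descend {M R : Type} [Group M] [Group R] (f : M →* R)
    (hf : Function.Surjective f) (μ : M →* ℂˣ) (hμ : ∀ n : M, f n = 1 → μ n = 1) : R →* ℂˣ where
  toFun r := μ (Classical.choose (hf r))
  map_one' := hμ _ (Classical.choose_spec (hf 1))
  map_mul' r r' := by
    rw [← map_mul]
    refine apply_eq_of_map_eq f μ hμ ?_
    rw [map_mul, Classical.choose_spec (hf r), Classical.choose_spec (hf r'),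
      Classical.choose_spec (hf (r * r'))]

/-- `λ̃ (f m) = μ m`. [folklore] -/
private theorem descend_apply_map {M R : Type} [Group M] [Group R] (f : M →* R)
    (hf : Function.Surjective f) (μ : M →* ℂˣ) (hμ : ∀ n : M, f n = 1 → μ n = 1) (m : M) :
    descend f hf μ hμ (f m) = μ m := by
  show μ (Classical.choose (hf (f m))) = μ m
  exact apply_eq_of_map_eq f μ hμ (Classical.choose_spec (hf (f m)))

variable {Γ K : Type} [Group Γ] [Fintype Γ] [Group K] [Fintype K]

/-- **Descent of weak almost monomiality along a surjection** `π : Γ ↠ K` (the argument of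
[Cimpoeas2024WAM, Theorem 2.9], there for `G ↠ G/N`). [cite: Cimpoeas2024WAM, Theorem 2.9 p. 6 (proof)] -/
theorem IsWeakAlmostMonomial.of_surjective (π : Γ →* K) (hπ : Function.Surjective π)
    (hΓ : IsWeakAlmostMonomial Γ) : IsWeakAlmostMonomial K := by
  classical
  intro ψ₁ hψ₁ ψ₂ hψ₂ hne
  have hc₁ : (ψ₁ ∘ π) ∈ irrChars Γ := IsIrrChar.comp_of_surjective π hπ hψ₁
  have hc₂ : (ψ₂ ∘ π) ∈ irrChars Γ := IsIrrChar.comp_of_surjective π hπ hψ₂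
  have hne' : (ψ₁ ∘ π) ≠ (ψ₂ ∘ π) := by
    intro h
    apply hne
    funext k
    obtain ⟨γ, rfl⟩ := hπ k
    exact congrFun h γ
  obtain ⟨M, μ, hlt⟩ := hΓ _ hc₁ _ hc₂ hne'
  -- the maps `f = π|_M : M → K`, `R = π(M)`, `f' : M ↠ R`
  set f : M →* K := π.comp M.subtype with hf_def
  set R : Subgroup K := f.range with hR_def
  set f' : M →* R := f.rangeRestrict with hf'_def
  have hf' : Function.Surjective f' := f.rangeRestrict_surjective
  have hf'_coe : ∀ m : M, ((f' m : R) : K) = π (m : Γ) := fun m => by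
    rw [hf'_def, MonoidHom.coe_rangeRestrict, hf_def]; rfl
  -- Frobenius reciprocity on `Γ`: `⟨ψ ∘ π, Ind_M μ⟩ = |M|⁻¹ Σ_m μ(m) ψ(π(m⁻¹))`
  have hFrobΓ : ∀ {ψ : K → ℂ}, ψ ∈ irrChars K →
      classInner (ψ ∘ π) (indClassFun M fun m => (μ m : ℂ)) =
        (Fintype.card M : ℂ)⁻¹ * ∑ m : M, (μ m : ℂ) * ψ (π ((m⁻¹ : M) : Γ)) := by
    intro ψ hψ
    have hcl : IsClassFun (ψ ∘ π) := (IsIrrChar.isCharacter (IsIrrChar.comp_of_surjective π hπ hψ)).isClassFun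
    rw [classInner_comm, classInner_indClassFun_left M _ hcl, classInner_apply]
    rfl
  by_cases hN : ∀ n : M, f' n = 1 → μ n = 1
  · -- Case B: `μ` descends to `λ̃` on `R`
    set lam : R →* ℂˣ := descend f' hf' μ hN with hlam_def
    have hlam : ∀ m : M, lam (f' m) = μ m := fun m => descend_apply_map f' hf' μ hN m
    -- Frobenius on `K`: `⟨ψ, Ind_R λ̃⟩ = |R|⁻¹ Σ_r λ̃(r) ψ(r⁻¹)`
    have hFrobK : ∀ {ψ : K → ℂ}, ψ ∈ irrChars K →
        classInner ψ (indClassFun R fun r => (lam r : ℂ)) =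
          (Fintype.card R : ℂ)⁻¹ * ∑ r : R, (lam r : ℂ) * ψ ((r⁻¹ : R) : K) := by
      intro ψ hψ
      rw [classInner_comm, classInner_indClassFun_left R _ (IsIrrChar.isCharacter hψ).isClassFun,
        classInner_apply]
    -- the two Frobenius sums agree
    have hcardM : (Fintype.card M : ℂ) = (Nat.card f'.ker : ℂ) * Fintype.card R := by
      have h := sum_comp_eq_card_ker_mul_sum f' hf' (fun _ => (1 : ℂ))
      simpa [Finset.sum_const, Finset.card_univ] using h
    have hkey : ∀ {ψ : K → ℂ}, ψ ∈ irrChars K →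
        classInner (ψ ∘ π) (indClassFun M fun m => (μ m : ℂ)) =
          classInner ψ (indClassFun R fun r => (lam r : ℂ)) := by
      intro ψ hψ
      rw [hFrobΓ hψ, hFrobK hψ]
      have hsum : ∑ m : M, (μ m : ℂ) * ψ (π ((m⁻¹ : M) : Γ)) =
          ∑ m : M, (fun r : R => (lam r : ℂ) * ψ ((r⁻¹ : R) : K)) (f' m) := by
        refine Finset.sum_congr rfl fun m _ => ?_
        simp only []
        rw [hlam m, ← hf'_coe (m⁻¹), map_inv]
      rw [hsum, sum_comp_eq_card_ker_mul_sum f' hf' (fun r : R => (lam r : ℂ) * ψ ((r⁻¹ : R) : K)),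
        hcardM]
      have hR0 : (Fintype.card R : ℂ) ≠ 0 := Nat.cast_ne_zero.mpr Fintype.card_ne_zero
      have hN0 : (Nat.card f'.ker : ℂ) ≠ 0 := by
        rw [Nat.card_eq_fintype_card]; exact Nat.cast_ne_zero.mpr Fintype.card_ne_zero
      field_simp
    refine ⟨R, lam, ?_⟩
    rw [← hkey hψ₁, ← hkey hψ₂]
    exact hlt
  · -- Case A: `μ` non-trivial on `ker f'`: both inner products vanish — impossible
    exfalso
    push Not at hN
    obtain ⟨n₀, hn₀, hμn₀⟩ := hN
    have hπn₀ : π (n₀ : Γ) = 1 := by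
      have h := hf'_coe n₀
      rw [hn₀] at h
      simpa using h.symm
    have hvanish : ∀ {ψ : K → ℂ}, ψ ∈ irrChars K →
        classInner (ψ ∘ π) (indClassFun M fun m => (μ m : ℂ)) = 0 := by
      intro ψ hψ
      rw [hFrobΓ hψ]
      set S := ∑ m : M, (μ m : ℂ) * ψ (π ((m⁻¹ : M) : Γ)) with hS
      have hreindex : S = (μ n₀ : ℂ) * S := by
        rw [hS, Finset.mul_sum]
        rw [← Equiv.sum_comp (Equiv.mulRight n₀)]
        refine Finset.sum_congr rfl fun m _ => ?_
        simp only [Equiv.coe_mulRight]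
        have hinv : π (((m * n₀)⁻¹ : M) : Γ) = π ((m⁻¹ : M) : Γ) := by
          simp only [mul_inv_rev, Subgroup.coe_mul, Subgroup.coe_inv, map_mul, map_inv]
          rw [hπn₀, inv_one, one_mul]
        rw [hinv, map_mul, Units.val_mul]
        ring
      have h1 : (1 - (μ n₀ : ℂ)) * S = 0 := by
        have := hreindex; linear_combination this
      have h2 : (1 - (μ n₀ : ℂ)) ≠ 0 := by
        intro h0
        apply hμn₀
        have : (μ n₀ : ℂ) = 1 := by linear_combination -h0
        exact Units.val_eq_one.mp this
      have hS0 : S = 0 := (mul_eq_zero.mp h1).resolve_left h2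
      rw [hS0, mul_zero]
    rw [hvanish hψ₁, hvanish hψ₂] at hlt
    exact lt_irrefl _ hlt

/-- **Cimpoeaş 2024, Theorem 2.10 (2) ⇒ (1):** a direct factor of a WAM-group is WAM
(descent along the projections). [cite: Cimpoeas2024WAM, Theorem 2.10 p. 6] -/
theorem IsWeakAlmostMonomial.of_prod {G' : Type} [Group G'] [Fintype G']
    (h : IsWeakAlmostMonomial (G × G')) : IsWeakAlmostMonomial G ∧ IsWeakAlmostMonomial G' :=
  ⟨h.of_surjective (MonoidHom.fst G G') Prod.fst_surjective,
    h.of_surjective (MonoidHom.snd G G') Prod.snd_surjective⟩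

end Descent

/-! ### The same descent for DM-positivity: Booker 2006, Proposition 2.2, first half (proved;
appended 2026-08-26)

Booker's proof of "if `G` is almost monomial, then so are quotients of `G`" (Exp. Math. 15, §2
Prop. 2.2 (1), p. 390: "if `σ = Ind_H^G λ` is a monomial representation then, by Frobenius
reciprocity … `λ` must factor through `H/H∩K ≅ HK/K` … `⟨χᵢ, σ⟩ = ⟨χ̃ᵢ, σ̃⟩ ≥ 0`") is the
dichotomy below for an arbitrary surjection `π : Γ ↠ K` and an arbitrary CLASS FUNCTION `ψ` on `K`:
`⟨ψ ∘ π, Ind_M μ⟩_Γ` is `0` if `μ` is non-trivial on `M ∩ ker π`, and `⟨ψ, Ind_{π(M)} λ̃⟩_K`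
otherwise. Hence DM-positive virtual characters inflate to DM-positive virtual characters, and
Booker-almost-monomiality descends along surjections (in particular to quotients `G/K`). The second
half of Prop. 2.2 (`G × H`, `H` monomial) is proved in the next section, and the named fact
`booker2006_proposition22` of `CertifiedArtinHolomorphyCriterion.lean` is DISCHARGED below
(`booker2006_proposition22_holds`). -/

section DescentDM

variable {Γ K : Type} [Group Γ] [Fintype Γ] [Group K] [Fintype K]

omit [Fintype K] in
/-- Frobenius form of `⟨ψ ∘ π, Ind_M μ⟩_Γ` for a class function `ψ` on `K`. [folklore] -/
private theorem classInner_comp_ind_eq_sum (π : Γ →* K) {ψ : K → ℂ} (hψ : IsClassFun ψ)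
    (M : Subgroup Γ) [Fintype M] (μ : M →* ℂˣ) :
    classInner (ψ ∘ π) (indClassFun M fun m => (μ m : ℂ)) =
      (Fintype.card M : ℂ)⁻¹ * ∑ m : M, (μ m : ℂ) * ψ (π ((m⁻¹ : M) : Γ)) := by
  classical
  have hcl : IsClassFun (ψ ∘ π) := by
    intro s t
    simp only [Function.comp_apply, map_mul, map_inv]
    exact hψ (π s) (π t)
  rw [classInner_comm, classInner_indClassFun_left M _ hcl, classInner_apply]
  rfl

omit [Fintype K] in
/-- **Dichotomy, vanishing branch:** if `μ` is non-trivial at some `n₀ ∈ M` with `π(n₀) = 1`, then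
`⟨ψ ∘ π, Ind_M μ⟩_Γ = 0` for every class function `ψ` on `K` (translate the Frobenius sum by `n₀`).
[cite: Booker2006, §2 Proposition 2.2 p. 390 (proof of part 1)] -/
theorem classInner_comp_ind_eq_zero (π : Γ →* K) {ψ : K → ℂ} (hψ : IsClassFun ψ)
    (M : Subgroup Γ) (μ : M →* ℂˣ) {n₀ : M} (hπn₀ : π (n₀ : Γ) = 1) (hμn₀ : μ n₀ ≠ 1) :
    classInner (ψ ∘ π) (indClassFun M fun m => (μ m : ℂ)) = 0 := by
  classical
  rw [classInner_comp_ind_eq_sum π hψ M μ]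
  set S := ∑ m : M, (μ m : ℂ) * ψ (π ((m⁻¹ : M) : Γ)) with hS
  have hreindex : S = (μ n₀ : ℂ) * S := by
    rw [hS, Finset.mul_sum]
    rw [← Equiv.sum_comp (Equiv.mulRight n₀)]
    refine Finset.sum_congr rfl fun m _ => ?_
    simp only [Equiv.coe_mulRight]
    have hinv : π (((m * n₀)⁻¹ : M) : Γ) = π ((m⁻¹ : M) : Γ) := by
      simp only [mul_inv_rev, Subgroup.coe_mul, Subgroup.coe_inv, map_mul, map_inv]
      rw [hπn₀, inv_one, one_mul]
    rw [hinv, map_mul, Units.val_mul]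
    ring
  have h1 : (1 - (μ n₀ : ℂ)) * S = 0 := by
    have := hreindex; linear_combination this
  have h2 : (1 - (μ n₀ : ℂ)) ≠ 0 := by
    intro h0
    apply hμn₀
    have : (μ n₀ : ℂ) = 1 := by linear_combination -h0
    exact Units.val_eq_one.mp this
  rw [(mul_eq_zero.mp h1).resolve_left h2, mul_zero]

/-- **Dichotomy, descent branch:** if `μ` is trivial on `M ∩ ker π` then
`⟨ψ ∘ π, Ind_M μ⟩_Γ = ⟨ψ, Ind_{π(M)} λ̃⟩_K` for every class function `ψ` on `K`, where `λ̃` is the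
push-forward of `μ` to `π(M)` (Booker's "`λ` must factor through `H/H∩K ≅ HK/K` … `⟨σ, ρ⟩ = ⟨σ̃, ρ̃⟩`").
[cite: Booker2006, §2 Proposition 2.2 p. 390 (proof of part 1)] -/
theorem classInner_comp_ind_eq_classInner_ind_descend (π : Γ →* K) {ψ : K → ℂ} (hψ : IsClassFun ψ)
    (M : Subgroup Γ) (μ : M →* ℂˣ)
    (hN : ∀ n : M, (π.comp M.subtype).rangeRestrict n = 1 → μ n = 1) :
    classInner (ψ ∘ π) (indClassFun M fun m => (μ m : ℂ)) =
      classInner ψ (indClassFun (π.comp M.subtype).range fun r =>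
        (descend (π.comp M.subtype).rangeRestrict (π.comp M.subtype).rangeRestrict_surjective μ hN r : ℂ)) := by
  classical
  set f : M →* K := π.comp M.subtype with hf_def
  set R : Subgroup K := f.range with hR_def
  set f' : M →* R := f.rangeRestrict with hf'_def
  have hf' : Function.Surjective f' := f.rangeRestrict_surjective
  have hf'_coe : ∀ m : M, ((f' m : R) : K) = π (m : Γ) := fun m => by
    rw [hf'_def, MonoidHom.coe_rangeRestrict, hf_def]; rfl
  set lam : R →* ℂˣ := descend f' hf' μ hN with hlam_def
  have hlam : ∀ m : M, lam (f' m) = μ m := fun m => descend_apply_map f' hf' μ hN m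
  rw [classInner_comp_ind_eq_sum π hψ M μ, classInner_comm,
    classInner_indClassFun_left R _ hψ, classInner_apply]
  have hcardM : (Fintype.card M : ℂ) = (Nat.card f'.ker : ℂ) * Fintype.card R := by
    have h := sum_comp_eq_card_ker_mul_sum f' hf' (fun _ => (1 : ℂ))
    simpa [Finset.sum_const, Finset.card_univ] using h
  have hsum : ∑ m : M, (μ m : ℂ) * ψ (π ((m⁻¹ : M) : Γ)) =
      ∑ m : M, (fun r : R => (lam r : ℂ) * ψ ((r⁻¹ : R) : K)) (f' m) := by
    refine Finset.sum_congr rfl fun m _ => ?_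
    simp only []
    rw [hlam m, ← hf'_coe (m⁻¹), map_inv]
  rw [hsum, sum_comp_eq_card_ker_mul_sum f' hf' (fun r : R => (lam r : ℂ) * ψ ((r⁻¹ : R) : K)),
    hcardM]
  have hR0 : (Fintype.card R : ℂ) ≠ 0 := Nat.cast_ne_zero.mpr Fintype.card_ne_zero
  have hN0 : (Nat.card f'.ker : ℂ) ≠ 0 := by
    rw [Nat.card_eq_fintype_card]; exact Nat.cast_ne_zero.mpr Fintype.card_ne_zero
  field_simp

/-- **DM-positivity inflates**: if `ψ` is a DM-positive class function on `K` and `π : Γ ↠ K` is a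
homomorphism (surjectivity is not needed here), then `ψ ∘ π` is DM-positive on `Γ`.
[cite: Booker2006, §2 Proposition 2.2 p. 390 (proof of part 1)] -/
theorem _root_.Literature.NumberTheory.LFunctions.Booker2006.IsDMPositive.comp (π : Γ →* K)
    {ψ : K → ℂ} (hψ : IsClassFun ψ) (hpos : IsDMPositive ψ) : IsDMPositive (ψ ∘ π) := by
  classical
  intro M μ
  by_cases hN : ∀ n : M, (π.comp M.subtype).rangeRestrict n = 1 → μ n = 1
  · rw [classInner_comp_ind_eq_classInner_ind_descend π hψ M μ hN]
    exact hpos _ _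
  · push Not at hN
    obtain ⟨n₀, hn₀, hμn₀⟩ := hN
    have hπn₀ : π (n₀ : Γ) = 1 := by
      have h : (((π.comp M.subtype).rangeRestrict n₀ : (π.comp M.subtype).range) : K) = π (n₀ : Γ) := by
        rw [MonoidHom.coe_rangeRestrict]; rfl
      rw [hn₀, OneMemClass.coe_one] at h
      exact h.symm
    rw [classInner_comp_ind_eq_zero π hψ M μ hπn₀ hμn₀]

/-- Virtual characters inflate along a surjection: `f ∈ R(K) ⇒ f ∘ π ∈ R(Γ)` (irreducibles pull back
to irreducibles, `IsIrrChar.comp_of_surjective`) — Booker's "Let `π`, `χᵢ` be the lifts of `π̃`, `χ̃ᵢ`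
to `G` obtained by composition with the natural projection".
[cite: Booker2006, §2 Proposition 2.2 p. 390 (proof of part 1)] -/
theorem comp_mem_virtChars (π : Γ →* K) (hπ : Function.Surjective π) {f : K → ℂ}
    (hf : f ∈ virtChars K) : (f ∘ π) ∈ virtChars Γ := by
  rw [mem_virtChars] at hf ⊢
  refine AddSubgroup.closure_induction (p := fun g _ => (g ∘ π) ∈ AddSubgroup.closure (irrChars Γ))
    ?_ ?_ ?_ ?_ hf
  · intro χ hχ
    exact AddSubgroup.subset_closure (IsIrrChar.comp_of_surjective π hπ hχ)
  · exact AddSubgroup.zero_mem _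
  · intro g g' _ _ hg hg'
    have : ((g + g') ∘ π) = (g ∘ π) + (g' ∘ π) := rfl
    rw [this]; exact AddSubgroup.add_mem _ hg hg'
  · intro g _ hg
    have : ((-g) ∘ π) = -(g ∘ π) := rfl
    rw [this]; exact AddSubgroup.neg_mem _ hg

/-- **Booker 2006, Proposition 2.2, first half — PROVED for surjections:** if `Γ` is almost monomial
(Booker's Definition 2.1) and `π : Γ ↠ K` is a surjective homomorphism, then `K` is almost monomial
("so are quotients of `G`": `K = G/K'`, `π` the projection). [cite: Booker2006, §2 Proposition 2.2 p. 389–390] -/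
theorem _root_.Literature.NumberTheory.LFunctions.Booker2006.IsAlmostMonomial.of_surjective
    (π : Γ →* K) (hπ : Function.Surjective π) (hΓ : IsAlmostMonomial Γ) : IsAlmostMonomial K := by
  intro ρ hρ χ₁ hχ₁ χ₂ hχ₂ hpos₁ hpos₂ hsum
  have hρ' : (ρ ∘ π) ∈ irrChars Γ := IsIrrChar.comp_of_surjective π hπ hρ
  have h := hΓ (ρ ∘ π) hρ' (χ₁ ∘ π) (comp_mem_virtChars π hπ hχ₁) (χ₂ ∘ π)
    (comp_mem_virtChars π hπ hχ₂) (hpos₁.comp π (isClassFun_of_mem_virtChars hχ₁))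
    (hpos₂.comp π (isClassFun_of_mem_virtChars hχ₂)) (by rw [hsum]; rfl)
  have descend_eq : ∀ {χ : K → ℂ}, (χ ∘ π) = 0 → χ = 0 := by
    intro χ h0
    funext k
    obtain ⟨γ, rfl⟩ := hπ k
    exact congrFun h0 γ
  rcases h with h | h
  · exact Or.inl (descend_eq h)
  · exact Or.inr (descend_eq h)

/-- **Booker 2006, Proposition 2.2, first half — quotients:** "If `G` is almost monomial, then so are
quotients of `G`." (The conjunction `booker2006_proposition22` also asserts the `G × H` half, not proved
here.) [cite: Booker2006, §2 Proposition 2.2 p. 389] -/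
theorem _root_.Literature.NumberTheory.LFunctions.Booker2006.IsAlmostMonomial.quotient
    (N : Subgroup Γ) [N.Normal] [Fintype (Γ ⧸ N)] (hΓ : IsAlmostMonomial Γ) :
    IsAlmostMonomial (Γ ⧸ N) :=
  hΓ.of_surjective (QuotientGroup.mk' N) (QuotientGroup.mk'_surjective N)

end DescentDM

/-! ### Booker 2006, Proposition 2.2, second half: `G × H` for a monomial `H` (proved; appended
2026-08-26) — and the discharge of `booker2006_proposition22`

Booker's proof (p. 390): write an irreducible of `G × H` as `ρ_G ⊗ ρ_H`; "taking the inner product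
over `H` with `ρ_H`" — the SLICE `⟨χ(g, ·), φ⟩_H` below — turns a DM-positive decomposition
`ρ_G ρ_H = χ₁ + χ₂` into the DM-positive decomposition `ρ_G = ⟨χ₁, ρ_H⟩_H + ⟨χ₂, ρ_H⟩_H` on `G`
(`⟨⟨χᵢ, ρ_H⟩_H, σ_G⟩_G = ⟨χᵢ, σ_G ⊗ ρ_H⟩_{G×H} ≥ 0` since `σ_G ⊗ ρ_H` is monomial for the M-group
`H`), so one slice vanishes; against any other `ρ'_H`, `0 = ⟨χ₁, ρ'_H⟩_H + ⟨χ₂, ρ'_H⟩_H` with both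
DM-positive forces both orthogonal to all monomial characters, hence zero by Brauer's induction theorem
in monomial form (the tree's `brauer_induction_holds`); so some `χᵢ` has all slices zero, i.e. is
orthogonal to every `ψ ⊗ φ`, i.e. `χᵢ = 0`. -/

section BookerProducts

variable {L : Type} [Group L] [Fintype L]

/-- Booker's "inner product over `H`": the slice `g ↦ ⟨χ(g, ·), φ⟩_H` (plumbing). [folklore] -/
private def sliceInner (χ : G × L → ℂ) (φ : L → ℂ) : G → ℂ := fun g => classInner (fun l => χ (g, l)) φ

omit [Group G] [Fintype G] in
/-- Additivity of the slice in `χ`. [folklore] -/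
private theorem sliceInner_add (χ χ' : G × L → ℂ) (φ : L → ℂ) :
    sliceInner (χ + χ') φ = sliceInner χ φ + sliceInner χ' φ := by
  funext g
  exact classInner_add_left _ _ _

omit [Group G] [Fintype G] in
/-- The slice of `ψ ⊗ φ'` against `φ` is `⟨φ', φ⟩_H ψ`. [folklore] -/
private theorem sliceInner_boxProd (ψ : G → ℂ) (φ' φ : L → ℂ) :
    sliceInner (fun p : G × L => ψ p.1 * φ' p.2) φ = fun g => ψ g * classInner φ' φ := by
  funext g
  show classInner (fun l => ψ g * φ' l) φ = ψ g * classInner φ' φ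
  rw [show (fun l => ψ g * φ' l) = ψ g • φ' from rfl, classInner_smul_left]

/-- `⟨⟨χ, φ⟩_H, σ⟩_G = ⟨χ, σ ⊗ φ⟩_{G×H}` ("taking the inner product over `H`").
[cite: Booker2006, §2 Proposition 2.2 p. 390 (proof of part 2)] -/
private theorem classInner_sliceInner (χ : G × L → ℂ) (φ : L → ℂ) (σ : G → ℂ) :
    classInner (sliceInner χ φ) σ = classInner χ (fun p : G × L => σ p.1 * φ p.2) := by
  simp only [classInner_apply, sliceInner, Fintype.card_prod, Nat.cast_mul, mul_inv,
    Fintype.sum_prod_type, Prod.inv_mk, Finset.mul_sum, Finset.sum_mul]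
  refine Finset.sum_congr rfl fun g _ => Finset.sum_congr rfl fun l _ => ?_
  ring

omit [Fintype G] in
/-- The slice of a class function is a class function. [folklore] -/
private theorem isClassFun_sliceInner {χ : G × L → ℂ} (hχ : IsClassFun χ) (φ : L → ℂ) :
    IsClassFun (sliceInner χ φ) := by
  intro s t
  show classInner (fun l => χ (t * s * t⁻¹, l)) φ = classInner (fun l => χ (s, l)) φ
  congr 1
  funext l
  have h := hχ (s, l) (t, 1)
  simpa using h

/-- The slice of a virtual character against an irreducible `φ` is a virtual character of `G`
(`⟨⟨χ, φ⟩_H, ψ⟩_G = ⟨χ, ψ ⊗ φ⟩ ∈ ℤ`). [cite: Booker2006, §2 Proposition 2.2 p. 390 (proof of part 2)] -/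
private theorem sliceInner_mem_virtChars {χ : G × L → ℂ} (hχ : χ ∈ virtChars (G × L)) {φ : L → ℂ}
    (hφ : φ ∈ irrChars L) : sliceInner χ φ ∈ virtChars G := by
  rw [mem_virtChars_iff]
  refine ⟨isClassFun_sliceInner (isClassFun_of_mem_virtChars hχ) φ, fun ψ hψ => ?_⟩
  rw [classInner_sliceInner]
  exact exists_int_classInner_of_mem_virtChars hχ (boxProd_mem_irrChars hψ hφ)

/-- For an M-group `H`, slices of DM-positive functions against irreducible `φ` are DM-positive
(`σ_G ⊗ φ = Ind_{H₀ × H₁}(λ ⊠ λ₁)` is monomial). [cite: Booker2006, §2 Proposition 2.2 p. 390 (proof of part 2)] -/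
private theorem isDMPositive_sliceInner (hL : IsMGroup L) {χ : G × L → ℂ} (hpos : IsDMPositive χ)
    {φ : L → ℂ} (hφ : φ ∈ irrChars L) : IsDMPositive (sliceInner χ φ) := by
  intro H₀ θ
  rw [classInner_sliceInner]
  obtain ⟨H₁, θ₁, hφeq⟩ := hL.exists_eq_indClassFun φ hφ
  rw [hφeq, ← indClassFun_prod_eq_boxProd]
  exact hpos _ _

/-- **Monomial characters detect class functions** (Brauer's induction theorem in monomial form,
Serre §10.5 Thm. 20, PROVED in the tree as `brauer_induction_holds`): a class function orthogonal
to every `Ind_H^G λ` is `0`. [cite: SerreLinearRepresentations1977, §10.5 Thm. 20] -/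
theorem eq_zero_of_forall_classInner_ind_eq_zero {v : G → ℂ} (hv : IsClassFun v)
    (h0 : ∀ (H₀ : Subgroup G) (θ : H₀ →* ℂˣ), classInner v (indClassFun H₀ fun h => (θ h : ℂ)) = 0) :
    v = 0 := by
  classical
  refine hv.eq_zero_of_forall_classInner_eq_zero fun ψ hψ => ?_
  obtain ⟨ι, _, Hs, θs, n, hψeq⟩ := brauer_induction_holds G ψ hψ.isCharacter
  rw [hψeq, classInner_comm, classInner_sum_left]
  refine Finset.sum_eq_zero fun i _ => ?_
  rw [classInner_smul_left, classInner_comm, h0, mul_zero]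

/-- Two DM-positive class functions with zero sum are both orthogonal to all monomial characters.
[folklore] -/
private theorem classInner_ind_eq_zero_of_add_eq_zero {v w : G → ℂ} (hv : IsDMPositive v)
    (hw : IsDMPositive w) (h : v + w = 0) (H₀ : Subgroup G) (θ : H₀ →* ℂˣ) :
    classInner v (indClassFun H₀ fun h => (θ h : ℂ)) = 0 := by
  have hs : classInner v (indClassFun H₀ fun h => (θ h : ℂ)) +
      classInner w (indClassFun H₀ fun h => (θ h : ℂ)) = 0 := by
    rw [← classInner_add_left, h, classInner_zero_left]
  have ha := hv H₀ θ
  have hb := hw H₀ θ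
  have hle : classInner v (indClassFun H₀ fun h => (θ h : ℂ)) ≤ 0 := by
    have : classInner v (indClassFun H₀ fun h => (θ h : ℂ)) =
        -classInner w (indClassFun H₀ fun h => (θ h : ℂ)) := by linear_combination hs
    rw [this]
    exact neg_nonpos.mpr hb
  exact le_antisymm hle ha

/-- **Booker 2006, Proposition 2.2, second half — PROVED:** "If `G` is almost monomial, then so are …
products `G × H` for any monomial group `H`." [cite: Booker2006, §2 Proposition 2.2 pp. 389–390] -/
theorem _root_.Literature.NumberTheory.LFunctions.Booker2006.IsAlmostMonomial.prod_of_isMGroup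
    (hG : IsAlmostMonomial G) (hL : IsMGroup L) : IsAlmostMonomial (G × L) := by
  classical
  intro ρ hρ χ₁ hχ₁ χ₂ hχ₂ hpos₁ hpos₂ hsum
  obtain ⟨ρG, hρG, ρL, hρL, rfl⟩ := exists_eq_boxProd_of_mem_irrChars hρ
  -- slices against `ρL`: `ρG = ⟨χ₁, ρL⟩_H + ⟨χ₂, ρL⟩_H`, a DM-positive decomposition on `G`
  have key : sliceInner χ₁ ρL = 0 ∨ sliceInner χ₂ ρL = 0 := by
    refine hG ρG hρG _ (sliceInner_mem_virtChars hχ₁ hρL) _ (sliceInner_mem_virtChars hχ₂ hρL)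
      (isDMPositive_sliceInner hL hpos₁ hρL) (isDMPositive_sliceInner hL hpos₂ hρL) ?_
    rw [← sliceInner_add, ← hsum, sliceInner_boxProd, IsIrrChar.classInner_eq (G := L) hρL hρL,
      if_pos rfl]
    funext g
    simp
  -- slices against the other irreducibles vanish for BOTH `χᵢ`
  have hzero : ∀ {φ : L → ℂ}, φ ∈ irrChars L → φ ≠ ρL →
      sliceInner χ₁ φ = 0 ∧ sliceInner χ₂ φ = 0 := by
    intro φ hφ hne
    have hs : sliceInner χ₁ φ + sliceInner χ₂ φ = 0 := by
      rw [← sliceInner_add, ← hsum, sliceInner_boxProd, IsIrrChar.classInner_eq (G := L) hρL hφ,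
        if_neg (fun h => hne h.symm)]
      funext g
      simp
    have hv₁ := isDMPositive_sliceInner hL hpos₁ hφ
    have hv₂ := isDMPositive_sliceInner hL hpos₂ hφ
    have hs' : sliceInner χ₂ φ + sliceInner χ₁ φ = 0 := by rw [add_comm]; exact hs
    exact ⟨eq_zero_of_forall_classInner_ind_eq_zero
        (isClassFun_sliceInner (isClassFun_of_mem_virtChars hχ₁) φ)
        (classInner_ind_eq_zero_of_add_eq_zero hv₁ hv₂ hs),
      eq_zero_of_forall_classInner_ind_eq_zero
        (isClassFun_sliceInner (isClassFun_of_mem_virtChars hχ₂) φ)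
        (classInner_ind_eq_zero_of_add_eq_zero hv₂ hv₁ hs')⟩
  -- a virtual character all of whose slices vanish is zero
  have conclude : ∀ {χ : G × L → ℂ}, χ ∈ virtChars (G × L) →
      (∀ φ ∈ irrChars L, sliceInner χ φ = 0) → χ = 0 := by
    intro χ hχ hall
    refine (isClassFun_of_mem_virtChars hχ).eq_zero_of_forall_classInner_eq_zero fun Ψ hΨ => ?_
    obtain ⟨ψ, hψ, φ, hφ, rfl⟩ := exists_eq_boxProd_of_mem_irrChars (K := G) (L := L) hΨ
    rw [← classInner_sliceInner, hall φ hφ, classInner_zero_left]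
  rcases key with h | h
  · left
    refine conclude hχ₁ fun φ hφ => ?_
    by_cases hφρ : φ = ρL
    · rw [hφρ]; exact h
    · exact (hzero hφ hφρ).1
  · right
    refine conclude hχ₂ fun φ hφ => ?_
    by_cases hφρ : φ = ρL
    · rw [hφρ]; exact h
    · exact (hzero hφ hφρ).2

end BookerProducts

end Cimpoeas2024

/-- **Booker 2006, Proposition 2.2 — DISCHARGED** (both halves: `Booker2006.IsAlmostMonomial.quotient`
and `Booker2006.IsAlmostMonomial.prod_of_isMGroup`). [cite: Booker2006, §2 Proposition 2.2 pp. 389–390] -/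
theorem booker2006_proposition22_holds : booker2006_proposition22 :=
  ⟨fun _ _ _ K _ _ hG => hG.quotient K, fun _ _ _ _ _ _ hG hH => hG.prod_of_isMGroup hH⟩

open Cimpoeas2024

/-! ### Closure properties (Theorems 2.9–2.10; CLAIM — preprint) -/

/-- **Cimpoeaş 2024, Theorem 2.9 (p. 6), as printed — CLAIM (preprint arXiv:2409.05629v1):** "Let
`N ⊴ G` be a normal subgroup of the WAM-group `G`. Then `G/N` is a WAM-group." (Proof in the source:
a separating `λ` of `H` induces a linear character `λ̃` of `HN/N` with the same inner products against
the inflated characters.) The binder `[Fintype (G ⧸ N)]` only supplies the finite type structure of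
the quotient. Not discharged here. [cite: Cimpoeas2024WAM, Theorem 2.9 p. 6] -/
def cimpoeas2024_theorem29 : Prop :=
  ∀ (G : Type) [Group G] [Fintype G] (N : Subgroup G) [N.Normal] [Fintype (G ⧸ N)],
    IsWeakAlmostMonomial G → IsWeakAlmostMonomial (G ⧸ N)

/-- **Cimpoeaş 2024, Theorem 2.10 (p. 6), as printed — CLAIM (preprint arXiv:2409.05629v1):** "Let
`G, G'` be two finite groups. The following assertions are equivalent: (1) `G, G'` are WAM-groups.
(2) `G × G'` is a WAM-group." ((1) ⇒ (2) from `Irr(G × G') = {χ × χ'}`; (2) ⇒ (1) from Theorem 2.9.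
The source remarks that the analogue for BAM-groups is open: "if `G₁` and `G₂` are BAM-groups, it is
not known, in general, that `G₁ × G₂` is also a BAM-group", p. 2.) Not discharged here.
[cite: Cimpoeas2024WAM, Theorem 2.10 p. 6] -/
def cimpoeas2024_theorem210 : Prop :=
  ∀ (G G' : Type) [Group G] [Fintype G] [Group G'] [Fintype G'],
    (IsWeakAlmostMonomial G ∧ IsWeakAlmostMonomial G') ↔ IsWeakAlmostMonomial (G × G')

/-- **Theorem 2.9 — DISCHARGED** (descent along `G ↠ G/N`, `Cimpoeas2024.IsWeakAlmostMonomial.of_surjective`).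
[cite: Cimpoeas2024WAM, Theorem 2.9 p. 6] -/
theorem cimpoeas2024_theorem29_holds : cimpoeas2024_theorem29 := by
  intro G _ _ N _ _ h
  exact h.of_surjective (QuotientGroup.mk' N) (QuotientGroup.mk'_surjective N)

/-- **Theorem 2.10 — DISCHARGED** ((1) ⇒ (2): `Cimpoeas2024.IsWeakAlmostMonomial.prod`;
(2) ⇒ (1): `Cimpoeas2024.IsWeakAlmostMonomial.of_prod`). [cite: Cimpoeas2024WAM, Theorem 2.10 p. 6] -/
theorem cimpoeas2024_theorem210_holds : cimpoeas2024_theorem210 := by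
  intro G G' _ _ _ _
  exact ⟨fun h => h.1.prod h.2, fun h => h.of_prod⟩

/-! ### Theorem 3.2: the simple-zero criterion (proved) -/

section ArtinHolomorphy

open Literature.NumberTheory.GaloisRepresentations Literature.NumberTheory.Automorphic Heilbronn

variable {F : Type} [Field F] [NumberField F] {G : Type} [Group G] [Fintype G]
  {q : Field.absoluteGaloisGroup F →* G}

/-- `n(G, λ^G) = Σ_{χ ∈ Irr(G)} n(G, χ) ⟨χ, λ^G⟩` — "for any virtual character
`χ = a₁χ₁ + ⋯ + a_rχ_r` we have `L(s, χ) = f₁^{a₁} ⋯ f_r^{a_r}`" (§3 p. 6) at the level of orders,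
from the tree's `⟨φ, θ_G⟩ = n(G, φ)`. [cite: Cimpoeas2024WAM, §3 p. 6] -/
theorem artinOrder_indClassFun_eq_sum (hq : IsArtinQuotient q) (s₀ : ℂ) (H : Subgroup G)
    (θ : H →* ℂˣ) :
    (artinOrder s₀ ((indClassFun H fun h => (θ h : ℂ)) ∘ q) : ℂ) =
      ∑ χ ∈ (irrChars_finite_holds G).toFinset,
        (artinOrder s₀ (χ ∘ q) : ℂ) * classInner χ (indClassFun H fun h => (θ h : ℂ)) := by
  classical
  rw [← classInner_heilbronnChar hq s₀ (isCharacter_indClassFun_monoidHom H θ), classInner_comm,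
    heilbronnChar, classInner_sum_left]
  refine Finset.sum_congr rfl fun χ _ => ?_
  rw [classInner_smul_left]

/-- **Cimpoeaş 2024, Theorem 3.2 (p. 7), as printed — PROVED:** "If the Galois group `G` is weak almost
monomial and there exists some `k` such that `ord_{s=s₀}(f_k) = 1` and `f_ℓ(s₀) ≠ 0` for all `ℓ ≠ k`,
then all Artin L-functions of `K/ℚ` are holomorphic at `s₀`." Setting (§3 p. 6): `Irr(G) =
{χ₁, …, χ_r}`, `f_i = L(s, χᵢ)`, `s₀ ∈ ℂ ∖ {1}` fixed. In the tree's Heilbronn vocabulary: `G` a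
finite Galois group over the number field `F` exhibited by `q : Γ_F → G` (`IsArtinQuotient q`),
`ord_{s₀} f_i = Heilbronn.artinOrder s₀ (χᵢ ∘ q)`; "`f_ℓ(s₀) ≠ 0`" (not a zero; a pole is not excluded
a priori — excluding it is the content) = `artinOrder ≤ 0`; conclusion: `artinOrder ≥ 0` for every
irreducible character. The printed proof, verbatim: if some `f_m` had a pole, a monomial
`σ = λ^G = Σ aᵢχᵢ` with `a_m > a_k ≥ 0` (WAM) has `L(s, σ)` holomorphic at `s₀ ≠ 1`
(`Heilbronn.artinOrder_indClassFun_nonneg`) yet `ord_{s₀} L(s, σ) = Σ aᵢ ord f_i ≤ −a_m + a_k < 0`.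
(The source states it over `ℚ`; the argument and this formalisation work over any number field `F`.)
[cite: Cimpoeas2024WAM, Theorem 3.2 p. 7] -/
theorem cimpoeas2024_theorem32 (hq : IsArtinQuotient q) {s₀ : ℂ} (hs₀ : s₀ ≠ 1)
    (hG : IsWeakAlmostMonomial G) {χk : G → ℂ} (hχk : χk ∈ irrChars G)
    (hk : artinOrder s₀ (χk ∘ q) = 1)
    (hℓ : ∀ χ ∈ irrChars G, χ ≠ χk → artinOrder s₀ (χ ∘ q) ≤ 0) :
    ∀ χ ∈ irrChars G, 0 ≤ artinOrder s₀ (χ ∘ q) := by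
  classical
  by_contra hcon
  push Not at hcon
  obtain ⟨χm, hχm, hm⟩ := hcon
  have hmk : χm ≠ χk := by
    rintro rfl
    omega
  -- a separating monomial character `σ = λ^G` with `a_k < a_m`
  obtain ⟨H, θ, hlt⟩ := hG χm hχm χk hχk hmk
  set σ : G → ℂ := indClassFun H fun h => (θ h : ℂ) with hσ_def
  -- natural multiplicities `a χ = ⟨χ, σ⟩`
  have ha' : ∀ χ : G → ℂ, ∃ a : ℕ, χ ∈ irrChars G → classInner χ σ = a := by
    intro χ
    by_cases hχ : χ ∈ irrChars G
    · obtain ⟨n, hn⟩ := (IsIrrChar.isCharacter hχ).classInner_natCast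
        (isCharacter_indClassFun_monoidHom H θ)
      exact ⟨n, fun _ => hn⟩
    · exact ⟨0, fun h => (hχ h).elim⟩
  choose a ha using ha'
  have hak_lt : a χk < a χm := by
    have h := hlt
    rw [ha χk hχk, ha χm hχm] at h
    rw [← Complex.ofReal_natCast, ← Complex.ofReal_natCast, Complex.real_lt_real] at h
    exact_mod_cast h
  -- `n(σ) ≥ 0` (`s₀ ≠ 1`)
  have hσnn : 0 ≤ artinOrder s₀ (σ ∘ q) := artinOrder_indClassFun_nonneg hq hs₀ H θ
  -- `n(σ) = Σ n(χ) a(χ)`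
  set S := (irrChars_finite_holds G).toFinset with hS_def
  have hmemS : ∀ {χ : G → ℂ}, χ ∈ S ↔ χ ∈ irrChars G := fun {χ} =>
    (irrChars_finite_holds G).mem_toFinset
  have hsumC : (artinOrder s₀ (σ ∘ q) : ℂ) =
      ∑ χ ∈ S, (artinOrder s₀ (χ ∘ q) : ℂ) * (a χ : ℂ) := by
    rw [hσ_def, artinOrder_indClassFun_eq_sum hq s₀ H θ]
    refine Finset.sum_congr rfl fun χ hχ => ?_
    rw [ha χ (hmemS.mp hχ)]
  have hsumZ : artinOrder s₀ (σ ∘ q) = ∑ χ ∈ S, artinOrder s₀ (χ ∘ q) * (a χ : ℤ) := by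
    exact_mod_cast hsumC
  -- split off `χm` and `χk`
  have hmS : χm ∈ S := hmemS.mpr hχm
  have hkS : χk ∈ S.erase χm := Finset.mem_erase.mpr ⟨hmk.symm, hmemS.mpr hχk⟩
  have hsplit : ∑ χ ∈ S, artinOrder s₀ (χ ∘ q) * (a χ : ℤ) =
      artinOrder s₀ (χm ∘ q) * (a χm : ℤ) + (artinOrder s₀ (χk ∘ q) * (a χk : ℤ) +
        ∑ χ ∈ (S.erase χm).erase χk, artinOrder s₀ (χ ∘ q) * (a χ : ℤ)) := by
    rw [← Finset.add_sum_erase S _ hmS, ← Finset.add_sum_erase (S.erase χm) _ hkS]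
  have hrest : ∑ χ ∈ (S.erase χm).erase χk, artinOrder s₀ (χ ∘ q) * (a χ : ℤ) ≤ 0 := by
    refine Finset.sum_nonpos fun χ hχ => ?_
    have hχk' : χ ≠ χk := (Finset.mem_erase.mp hχ).1
    have hχS : χ ∈ irrChars G := hmemS.mp (Finset.mem_of_mem_erase (Finset.mem_of_mem_erase hχ))
    exact mul_nonpos_of_nonpos_of_nonneg (hℓ χ hχS hχk') (by positivity)
  have hmterm : artinOrder s₀ (χm ∘ q) * (a χm : ℤ) ≤ -(a χm : ℤ) := by
    have : artinOrder s₀ (χm ∘ q) ≤ -1 := by omega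
    nlinarith
  rw [hsumZ, hsplit, hk, one_mul] at hσnn
  omega

/-- **Theorem 3.2, character form:** under the same hypotheses EVERY character `φ` of `G` has
`ord_{s₀} L(s, φ) ≥ 0` — "all Artin L-functions of `K/ℚ` are holomorphic at `s₀`" for the
`L`-functions of all representations, by additivity over the irreducible decomposition
(`Heilbronn.artinOrder_comp_multiset_sum`). [cite: Cimpoeas2024WAM, Theorem 3.2 p. 7] -/
theorem cimpoeas2024_theorem32_character (hq : IsArtinQuotient q) {s₀ : ℂ} (hs₀ : s₀ ≠ 1)
    (hG : IsWeakAlmostMonomial G) {χk : G → ℂ} (hχk : χk ∈ irrChars G)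
    (hk : artinOrder s₀ (χk ∘ q) = 1)
    (hℓ : ∀ χ ∈ irrChars G, χ ≠ χk → artinOrder s₀ (χ ∘ q) ≤ 0)
    {φ : G → ℂ} (hφ : IsCharacter G φ) : 0 ≤ artinOrder s₀ (φ ∘ q) := by
  obtain ⟨m, hm, rfl⟩ := hφ.exists_multiset_irrChars
  rw [artinOrder_comp_multiset_sum hq s₀ fun χ hχ => (hm χ hχ).isCharacter]
  refine Multiset.sum_nonneg fun x hx => ?_
  obtain ⟨χ, hχ, rfl⟩ := Multiset.mem_map.mp hx
  exact cimpoeas2024_theorem32 hq hs₀ hG hχk hk hℓ χ (hm χ hχ)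

/-- **Theorem 3.2 for Booker's almost monomial groups** (Proposition 2.4 (1) + Theorem 3.2): for an
almost monomial Galois group in Booker's sense, a point `s₀ ≠ 1` that is a simple zero of exactly one
irreducible Artin `L`-function and a zero of no other is a holomorphy point of all of them.
[cite: Cimpoeas2024WAM, Proposition 2.4 (1) p. 4 and Theorem 3.2 p. 7] -/
theorem artinOrder_nonneg_of_isAlmostMonomial_of_simple_zero (hq : IsArtinQuotient q) {s₀ : ℂ}
    (hs₀ : s₀ ≠ 1) (hG : IsAlmostMonomial G) {χk : G → ℂ} (hχk : χk ∈ irrChars G)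
    (hk : artinOrder s₀ (χk ∘ q) = 1)
    (hℓ : ∀ χ ∈ irrChars G, χ ≠ χk → artinOrder s₀ (χ ∘ q) ≤ 0) :
    ∀ χ ∈ irrChars G, 0 ≤ artinOrder s₀ (χ ∘ q) :=
  cimpoeas2024_theorem32 hq hs₀ (isWeakAlmostMonomial_of_isAlmostMonomial hG) hχk hk hℓ

end ArtinHolomorphy

end Literature.NumberTheory.LFunctions

end
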